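import Literature.NumberTheory.GaloisRepresentations.LocalArtinMapPinned
import Literature.NumberTheory.GaloisRepresentations.LocalCFTFromReciprocitySystem
import Literature.NumberTheory.GaloisRepresentations.LocalReciprocityNormFunctoriality
import Literature.NumberTheory.GaloisRepresentations.TateLevelOneLocalCharacters
import HarnessLib

/-!
# Halving locally constant characters of `Mˣ`, and the class-field dictionary for
# finite-order characters of `Γ_M` (`M` a non-archimedean local field)

Topic `Literature/NumberTheory/GaloisRepresentations`.  THEOREMS ONLY (no definition, no named
fact, no instance).  Additive characters are functions `ψ` with `ψ (x y) = ψ x + ψ y` into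
`ℚ/ℤ = AddCircle (1 : ℚ)` (the convention of `TateLevelOneLocalCharacters.lean`,
`TateH2VanishingCharacterCriterion.lean`); "locally constant" = continuous for the discrete topology.

* `character_exists_two_nsmul_eq_of_sq_mem` — ALGEBRA: for an abelian group `G`, a subgroup `N`
  and a character `ψ` with `g² ∈ N ⇒ ψ g = 0`, there is a character `ψ'` killing `N` with
  `2 • ψ' = ψ` (define `ψ' (n g²) = ψ g` on `N · G²`, extend by injectivity of `ℚ/ℤ`, Baer).
* `exists_isOpen_sq_mem_imp_apply_eq_zero` — COMPACTNESS: for a locally constant character `ψ` of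
  `Mˣ` with `ψ (-1) = 0` some open subgroup `N ≤ 𝒪_Mˣ` has `u ∈ 𝒪_Mˣ, u² ∈ N ⇒ ψ u = 0`
  (`𝒪_Mˣ` is compact, `isCompact_unitGroup`; open subgroups of finite index separate points,
  `exists_isOpen_finiteIndex_notMem`; the only square roots of `1` are `±1`).
* `units_character_exists_two_nsmul_eq_of_apply_neg_one` — **a locally constant character of `Mˣ`
  killing `-1` is twice a locally constant character** (the two items above; `Mˣ[2] = {±1}`, so
  this is "`ψ` kills the `2`-torsion ⇒ `ψ ∈ 2 · Hom_cont(Mˣ, ℚ/ℤ)`", Pontryagin).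
* `exists_units_character_comp_canonicalArtin` — a locally constant character `ν` of `Γ_M`
  factors on the Weil group through THE local Artin map: `ν|_{W_M} = χ ∘ Art_M`
  (`canonicalArtin M`, with its clauses `isLocalArtinMap_canonicalArtin_holds`: `Art_M` is an open
  quotient map with kernel `closure [W_M, W_M]`; Tate (1.4.5), local Langlands for `GL₁`).
* `exists_absGalois_character_of_units_character` — conversely a character `ψ` of `Mˣ` killing an
  open subgroup of finite index gives a locally constant character `μ` of `Γ_M` with
  `μ|_{W_M} = ψ ∘ Art_M`: the existence theorem (`exists_intermediateField_normSubgroup_eq`, proved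
  in `LocalCFTFromReciprocitySystem.lean` from `LocalWeilDatum.exists_isReciprocitySystem_holds`)
  and the reciprocity law at finite level (`IsLocalArtinMap.artin_mem_range_norm_iff`) identify
  `ker (ψ ∘ Art_M) ⊇ W_M ∩ Γ_E` for a finite abelian `E/M`, and `W_M` is dense
  (`WeilGroup.denseRange_toAbsGalois_holds`).  Stated for `M` of characteristic `0` (so that
  `M̄/M` is Galois and `Γ_E ⊴ Γ_M`).

Consumed by the summit `Langlands` (route `NonParallelVoid`, crux `TwistedInductionParallel`):
restricted to a quadratic extension `M/L`, a finite-order character `ν` of `Γ_L` becomes twice a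
finite-order character (`ν ∘ res|_{W_M} = χ ∘ N_{M/L} ∘ Art_M` by `canonicalArtin_map`, and
`χ (N(-1)) = χ (1) = 0`).  NOT here: Pontryagin duality in general, the structure of `𝒪_Mˣ`.

## References

* J.-P. Serre, *Local Fields*, GTM 67 (1979), Ch. XIII §4 (Thm. 1–2, Prop. 10), Ch. XIV §6
  (Thm. 1, Cor. 2 and Remark 2). [SerreLocalFields1979]
* J. Tate, *Number theoretic background*, Corvallis 1979, (1.4.1)–(1.4.6). [Corvallis1979]
* L. Ribes, P. Zalesskii, *Profinite Groups* (2010), Lemma 2.1.2, §2.9. [RibesZalesskii2010]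
-/

noncomputable section

open Field ValuativeRel Topology

namespace Literature.NumberTheory.GaloisRepresentations

open GaloisRepresentations.IsNonarchimedeanLocalField

universe u

/-! ### Halving a character that kills the elements whose square lies in a subgroup -/

section Algebra

/-- **Halving an additive character, algebraic step.**  Let `G` be an abelian group,
`ψ : G → ℚ/ℤ` an additive character and `N ≤ G` a subgroup such that `ψ g = 0` whenever `g² ∈ N`.
Then `ψ = 2 • ψ'` for an additive character `ψ'` which kills `N`: on `N · G²` put
`ψ' (n g²) = ψ g` (well defined exactly by the hypothesis), and extend to `G` by divisibility of
`ℚ/ℤ` (an injective `ℤ`-module, Baer). [folklore] -/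
theorem character_exists_two_nsmul_eq_of_sq_mem {G : Type*} [CommGroup G]
    (ψ : G → AddCircle (1 : ℚ)) (hψ : ∀ x y, ψ (x * y) = ψ x + ψ y) (N : Subgroup G)
    (hN : ∀ g : G, g ^ 2 ∈ N → ψ g = 0) :
    ∃ ψ' : G → AddCircle (1 : ℚ), (∀ x y, ψ' (x * y) = ψ' x + ψ' y) ∧ (∀ n ∈ N, ψ' n = 0) ∧
      ∀ g, 2 • ψ' g = ψ g := by
  classical
  -- well-definedness of `n g² ↦ ψ g`
  have hwd : ∀ (n n' a a' : G), n ∈ N → n' ∈ N → n * a ^ 2 = n' * a' ^ 2 → ψ a = ψ a' := by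
    intro n n' a a' hn hn' heq
    have hb : (a * a'⁻¹) ^ 2 = n⁻¹ * n' := by
      have : n' = n * a ^ 2 * (a' ^ 2)⁻¹ := by rw [heq, mul_inv_cancel_right]
      rw [mul_pow, inv_pow, this]
      group
    have hmem : (a * a'⁻¹) ^ 2 ∈ N := by rw [hb]; exact N.mul_mem (N.inv_mem hn) hn'
    have h0 := hN _ hmem
    rw [hψ, character_apply_inv hψ, ← sub_eq_add_neg, sub_eq_zero] at h0
    exact h0
  set S : Subgroup G := N ⊔ (powMonoidHom 2 : G →* G).range with hS
  have hmemS : ∀ x : G, x ∈ S ↔ ∃ n ∈ N, ∃ a : G, n * a ^ 2 = x := by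
    intro x
    rw [hS, Subgroup.mem_sup]
    constructor
    · rintro ⟨n, hn, z, ⟨a, rfl⟩, rfl⟩
      exact ⟨n, hn, a, rfl⟩
    · rintro ⟨n, hn, a, rfl⟩
      exact ⟨n, hn, a ^ 2, ⟨a, rfl⟩, rfl⟩
  have hdec : ∀ x : S, ∃ n : G, n ∈ N ∧ ∃ a : G, n * a ^ 2 = x := fun x => by
    obtain ⟨n, hn, a, h⟩ := (hmemS x).1 x.2
    exact ⟨n, hn, a, h⟩
  choose dn hdn da hda using hdec
  have hf : ∀ (x : S) (n a : G), n ∈ N → n * a ^ 2 = x → ψ (da x) = ψ a :=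
    fun x n a hn h => hwd _ _ _ _ (hdn x) hn ((hda x).trans h.symm)
  -- the additive shadow `g : Additive S →+ ℚ/ℤ`
  let g : Additive S →+ AddCircle (1 : ℚ) := AddMonoidHom.mk' (fun x => ψ (da (Additive.toMul x)))
    (fun x y => by
      have hxy : dn (Additive.toMul x) * dn (Additive.toMul y) *
          (da (Additive.toMul x) * da (Additive.toMul y)) ^ 2 =
          ((Additive.toMul x * Additive.toMul y : S) : G) := by
        rw [Subgroup.coe_mul, ← hda (Additive.toMul x), ← hda (Additive.toMul y), mul_pow]
        exact mul_mul_mul_comm _ _ _ _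
      rw [toMul_add, hf _ _ _ (N.mul_mem (hdn _) (hdn _)) hxy, hψ])
  have hB : Module.Baer ℤ (AddCircle (1 : ℚ)) := Module.Baer.of_divisible _
  have hinj : Function.Injective (MonoidHom.toAdditive S.subtype) := fun a b hab =>
    Additive.toMul.injective (S.subtype_injective (Additive.ofMul.injective hab))
  obtain ⟨h, hh⟩ := hB.extension_property_addMonoidHom (MonoidHom.toAdditive S.subtype) hinj g
  have hext : ∀ x : S, h (Additive.ofMul (x : G)) = ψ (da x) := fun x => by
    have hx := DFunLike.congr_fun hh (Additive.ofMul x)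
    rw [AddMonoidHom.comp_apply] at hx
    exact hx
  refine ⟨fun x => h (Additive.ofMul x), fun x y => ?_, fun n hn => ?_, fun x => ?_⟩
  · dsimp only
    rw [ofMul_mul, map_add]
  · have hnS : n ∈ S := (hmemS n).2 ⟨n, hn, 1, by rw [one_pow, mul_one]⟩
    dsimp only
    rw [show h (Additive.ofMul n) = h (Additive.ofMul ((⟨n, hnS⟩ : S) : G)) from rfl, hext,
      hf ⟨n, hnS⟩ n 1 hn (by rw [one_pow, mul_one]), character_apply_one hψ]
  · have hxS : x ^ 2 ∈ S := (hmemS _).2 ⟨1, N.one_mem, x, one_mul _⟩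
    dsimp only
    rw [← map_nsmul, ← ofMul_pow,
      show h (Additive.ofMul (x ^ 2)) = h (Additive.ofMul ((⟨x ^ 2, hxS⟩ : S) : G)) from rfl, hext,
      hf ⟨x ^ 2, hxS⟩ 1 x N.one_mem (one_mul _)]

end Algebra

/-! ### Halving a locally constant character of `Mˣ` that kills `-1` -/

section Units

variable (M : Type u) [Field M] [ValuativeRel M] [TopologicalSpace M] [IsNonarchimedeanLocalField M]

/-- **Compactness step.**  For a locally constant additive character `ψ : Mˣ → ℚ/ℤ` of the
multiplicative group of a non-archimedean local field with `ψ (-1) = 0`, some open subgroup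
`N ≤ 𝒪_Mˣ` satisfies: `u ∈ 𝒪_Mˣ`, `u² ∈ N ⇒ ψ u = 0`.  (Otherwise the closed subsets
`{u ∈ 𝒪_Mˣ | u² ∈ N, ψ u ≠ 0}` of the compact unit group (`isCompact_unitGroup`) have a common
point `u`; `u²` lies in every open subgroup of finite index, so `u² = 1`
(`exists_isOpen_finiteIndex_notMem`), `u = ±1` and `ψ u = 0`.)  This is the finite-level shadow of
"a character of the profinite group `𝒪_Mˣ` killing the `2`-torsion `{±1}` is a square".
Ref: Serre, *Local Fields* (1979), Ch. XIV §6 (proof of Cor. 2: `⋂ V = 1`); Ribes–Zalesskii,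
*Profinite Groups*, Lemma 2.1.2. [folklore] -/
theorem exists_isOpen_sq_mem_imp_apply_eq_zero (ψ : Mˣ → AddCircle (1 : ℚ))
    (hlc : IsLocallyConstant ψ) (hψ : ∀ x y, ψ (x * y) = ψ x + ψ y) (hneg : ψ (-1) = 0) :
    ∃ N : Subgroup Mˣ, IsOpen (N : Set Mˣ) ∧ N ≤ (valuation M).valuationSubring.unitGroup ∧
      ∀ u ∈ (valuation M).valuationSubring.unitGroup, u ^ 2 ∈ N → ψ u = 0 := by
  classical
  set U : Subgroup Mˣ := (valuation M).valuationSubring.unitGroup with hU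
  by_contra hcon
  push Not at hcon
  -- the directed family of closed nonempty subsets of the compact `U`
  let ι := {V : Subgroup Mˣ // IsOpen (V : Set Mˣ) ∧ V ≤ U}
  haveI : Nonempty ι := ⟨⟨U, isOpen_unitGroup, le_rfl⟩⟩
  let t : ι → Set Mˣ := fun V => {a | a ∈ U ∧ a ^ 2 ∈ (V : Subgroup Mˣ) ∧ ψ a ≠ 0}
  have htcl : ∀ V, IsClosed (t V) := fun V => by
    have h1 : IsClosed (U : Set Mˣ) := U.isClosed_of_isOpen isOpen_unitGroup
    have h2 : IsClosed ((fun a : Mˣ => a ^ 2) ⁻¹' ((V : Subgroup Mˣ) : Set Mˣ)) :=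
      ((V : Subgroup Mˣ).isClosed_of_isOpen V.2.1).preimage (continuous_pow 2)
    have h3 : IsClosed {a : Mˣ | ψ a ≠ 0} := by
      have : {a : Mˣ | ψ a ≠ 0} = (ψ ⁻¹' {0})ᶜ := by ext a; simp
      rw [this]
      exact (hlc.isOpen_fiber 0).isClosed_compl
    have hset : t V = (U : Set Mˣ) ∩ (fun a : Mˣ => a ^ 2) ⁻¹' ((V : Subgroup Mˣ) : Set Mˣ) ∩
        {a : Mˣ | ψ a ≠ 0} := by
      ext a
      simp only [t, Set.mem_setOf_eq, Set.mem_inter_iff, Set.mem_preimage, SetLike.mem_coe, and_assoc]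
    rw [hset]
    exact (h1.inter h2).inter h3
  have htne : ∀ V, (t V).Nonempty := fun V => by
    obtain ⟨u, hu, hu2, hne⟩ := hcon V V.2.1 V.2.2
    exact ⟨u, hu, hu2, hne⟩
  have htd : Directed (· ⊇ ·) t := fun V V' => by
    refine ⟨⟨(V : Subgroup Mˣ) ⊓ V', V.2.1.inter V'.2.1, inf_le_left.trans V.2.2⟩, ?_, ?_⟩
    · rintro a ⟨h1, h2, h3⟩
      exact ⟨h1, h2.1, h3⟩
    · rintro a ⟨h1, h2, h3⟩
      exact ⟨h1, h2.2, h3⟩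
  have htc : ∀ V, IsCompact (t V) := fun V =>
    (isCompact_unitGroup M).of_isClosed_subset (htcl V) fun a ha => ha.1
  obtain ⟨a, ha⟩ := IsCompact.nonempty_iInter_of_directed_nonempty_isCompact_isClosed t htd htne
    htc htcl
  rw [Set.mem_iInter] at ha
  obtain ⟨haU, -, hane⟩ := ha (Classical.arbitrary ι)
  -- `a²` lies in every open subgroup `≤ U`, hence `a² = 1`
  have hsq : a ^ 2 = 1 := by
    by_contra hne
    obtain ⟨V, hVopen, -, haV⟩ := exists_isOpen_finiteIndex_notMem M hne
    exact haV ((ha ⟨V ⊓ U, hVopen.inter isOpen_unitGroup, inf_le_right⟩).2.1).1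
  have hsq' : (a : M) ^ 2 = 1 := by rw [← Units.val_pow_eq_pow_val, hsq, Units.val_one]
  rcases sq_eq_one_iff.mp hsq' with h1 | h1
  · exact hane (by rw [Units.val_eq_one.mp h1]; exact character_apply_one hψ)
  · have : a = -1 := Units.ext (by rw [h1, Units.val_neg, Units.val_one])
    exact hane (by rw [this]; exact hneg)

/-- **A locally constant character of `Mˣ` killing `-1` is twice a locally constant character.**
For a non-archimedean local field `M` and a locally constant additive character `ψ : Mˣ → ℚ/ℤ` with
`ψ (-1) = 0` there is a locally constant additive character `ψ'` of `Mˣ` with `2 • ψ' = ψ`.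
Proof: with `N` as in `exists_isOpen_sq_mem_imp_apply_eq_zero` (note `g² ∈ N ≤ 𝒪_Mˣ` forces
`g ∈ 𝒪_Mˣ`), `character_exists_two_nsmul_eq_of_sq_mem` yields `ψ'` killing the open subgroup `N`,
hence locally constant.  (The only `2`-torsion of `Mˣ` is `±1`, so the hypothesis says that `ψ`
kills `Mˣ[2]`; by Pontryagin duality for `Mˣ ≅ ℤ × 𝒪_Mˣ` this is equivalent to `ψ ∈ 2 · Hom`.)
Ref: Serre, *Local Fields* (1979), Ch. XIV §6; Ribes–Zalesskii, *Profinite Groups*, §2.9.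
[folklore] -/
theorem units_character_exists_two_nsmul_eq_of_apply_neg_one (ψ : Mˣ → AddCircle (1 : ℚ))
    (hlc : IsLocallyConstant ψ) (hψ : ∀ x y, ψ (x * y) = ψ x + ψ y) (hneg : ψ (-1) = 0) :
    ∃ ψ' : Mˣ → AddCircle (1 : ℚ), IsLocallyConstant ψ' ∧ (∀ x y, ψ' (x * y) = ψ' x + ψ' y) ∧
      ∀ g, 2 • ψ' g = ψ g := by
  obtain ⟨N, hNopen, hNU, hN⟩ := exists_isOpen_sq_mem_imp_apply_eq_zero M ψ hlc hψ hneg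
  have hN' : ∀ g : Mˣ, g ^ 2 ∈ N → ψ g = 0 := fun g hg => by
    refine hN g ?_ hg
    have h2 : valuation M ((g : M) ^ 2) = 1 := by
      rw [← Units.val_pow_eq_pow_val]
      exact (Valuation.mem_unitGroup_iff _ _ _).mp (hNU hg)
    rw [map_pow] at h2
    exact (Valuation.mem_unitGroup_iff _ _ _).mpr
      ((pow_eq_one_iff_of_nonneg zero_le two_ne_zero).mp h2)
  obtain ⟨ψ', hadd, hker, h2⟩ := character_exists_two_nsmul_eq_of_sq_mem ψ hψ N hN'
  refine ⟨ψ', ?_, hadd, h2⟩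
  exact isLocallyConstant_of_mul_mem ψ' N hNopen fun σ u hu => by rw [hadd, hker u hu, add_zero]

end Units

/-! ### The dictionary: locally constant characters of `Γ_M`, of `W_M`, and of `Mˣ` -/

section Galois

variable (M : Type u) [Field M] [ValuativeRel M] [TopologicalSpace M] [IsNonarchimedeanLocalField M]

/-- **A locally constant character of `Γ_M` factors through THE local Artin map.**  For a locally
constant additive character `ν : Γ_M → ℚ/ℤ` there is an additive character `χ : Mˣ → ℚ/ℤ` with
`χ (Art_M w) = ν w` on the Weil group: `ν|_{W_M}` kills `[W_M, W_M]` (abelian target) and, its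
kernel being closed for the Weil topology (`W_M → Γ_M` is continuous), also
`closure [W_M, W_M] = ker Art_M` (`IsLocalArtinMap.ker_artin` for `canonicalArtin M`,
`isLocalArtinMap_canonicalArtin_holds`); and `Art_M` is surjective.
Ref: Tate, *Number theoretic background* (Corvallis 1979), (1.4.5); Serre, *Local Fields* (1979),
Ch. XIII §4. [cite: Corvallis1979, (1.4.5)] -/
theorem exists_units_character_comp_canonicalArtin (ν : absoluteGaloisGroup M → AddCircle (1 : ℚ))
    (hlc : IsLocallyConstant ν) (hν : ∀ σ τ, ν (σ * τ) = ν σ + ν τ) :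
    ∃ χ : Mˣ → AddCircle (1 : ℚ), (∀ x y, χ (x * y) = χ x + χ y) ∧
      ∀ w : WeilGroup M, χ (canonicalArtin M w) = ν (WeilGroup.toAbsGalois M w) := by
  have hart := isLocalArtinMap_canonicalArtin_holds M
  obtain ⟨f, hf, hfker⟩ := exists_monoidHom_ker_iff hν
  set fW : WeilGroup M →* Multiplicative (AddCircle (1 : ℚ)) := f.comp (WeilGroup.toAbsGalois M)
    with hfW
  have hle : (canonicalArtin M).ker ≤ fW.ker := by
    intro w hw
    have hw' : w ∈ closure (commutator (WeilGroup M) : Set (WeilGroup M)) := by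
      rw [← hart.ker_artin]; exact hw
    have hclosed : IsClosed (fW.ker : Set (WeilGroup M)) := by
      have hset : (fW.ker : Set (WeilGroup M)) = WeilGroup.toAbsGalois M ⁻¹' (ν ⁻¹' {0}) := by
        ext x
        rw [SetLike.mem_coe, MonoidHom.mem_ker, hfW, MonoidHom.comp_apply, ← MonoidHom.mem_ker, hfker]
        rfl
      rw [hset]
      exact (hlc.isClosed_fiber 0).preimage (WeilGroup.toAbsGaloisContinuous M).continuous
    exact closure_minimal (fun x hx => Abelianization.commutator_subset_ker fW hx) hclosed hw'
  set χ₀ : Mˣ →* Multiplicative (AddCircle (1 : ℚ)) :=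
    (canonicalArtin M).liftOfSurjective hart.isOpenQuotientMap_artin.surjective ⟨fW, hle⟩ with hχ₀
  have hχ₀w : ∀ w, χ₀ (canonicalArtin M w) = fW w := fun w =>
    (canonicalArtin M).liftOfRightInverse_comp_apply _ _ ⟨fW, hle⟩ w
  refine ⟨fun x => Multiplicative.toAdd (χ₀ x), fun x y => by simp only [map_mul, toAdd_mul],
    fun w => ?_⟩
  simp only [hχ₀w, hfW, MonoidHom.comp_apply, hf, toAdd_ofAdd]

variable [CharZero M]

/-- **From `Mˣ` back to `Γ_M`** (the reciprocity law at finite level plus the existence theorem).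
Let `ψ : Mˣ → A` be an additive character killing an open subgroup `K ≤ Mˣ` of finite index.  Then
there is a locally constant additive character `μ : Γ_M → A` with `μ w = ψ (Art_M w)` on the Weil
group: `K = N_{E/M}(Eˣ)` for a finite abelian `E/M` (existence theorem,
`exists_intermediateField_normSubgroup_eq`, PROVED in the tree), `Art_M w ∈ N(Eˣ) ↔ w ∈ Γ_E`
(`IsLocalArtinMap.artin_mem_range_norm_iff`), so `ψ ∘ Art_M` is constant on the traces on `W_M` of
the cosets of the open normal subgroup `Γ_E`, each of which meets the dense `W_M`
(`WeilGroup.denseRange_toAbsGalois_holds`).  (`CharZero M` makes `M̄/M` Galois, so that `Γ_E` is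
normal.)  Ref: Serre, *Local Fields* (1979), Ch. XIII §4 Thm. 2, Ch. XIV §6 Thm. 1; Milne,
*Class Field Theory*, Ch. I Thm. 1.1. [cite: SerreLocalFields1979, Ch. XIV §6 Thm. 1] -/
theorem exists_absGalois_character_of_units_character {A : Type*} [AddCommGroup A] (ψ : Mˣ → A)
    (hψ : ∀ x y, ψ (x * y) = ψ x + ψ y) (K : Subgroup Mˣ) (hKopen : IsOpen (K : Set Mˣ))
    (hKfin : K.FiniteIndex) (hK : ∀ k ∈ K, ψ k = 0) :
    ∃ μ : absoluteGaloisGroup M → A, IsLocallyConstant μ ∧ (∀ σ τ, μ (σ * τ) = μ σ + μ τ) ∧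
      ∀ w : WeilGroup M, μ (WeilGroup.toAbsGalois M w) = ψ (canonicalArtin M w) := by
  classical
  have hart := isLocalArtinMap_canonicalArtin_holds M
  obtain ⟨E, hEfin, hEab, hE⟩ :=
    exists_intermediateField_normSubgroup_eq_of_exists_isReciprocitySystem M
      (LocalWeilDatum.exists_isReciprocitySystem_holds M) K hKopen hKfin
  haveI := hEfin
  haveI := hEab
  set H : Subgroup (absoluteGaloisGroup M) := E.fixingSubgroup with hH
  have hHopen : IsOpen (H : Set (absoluteGaloisGroup M)) := E.fixingSubgroup_isOpen
  haveI hHn : H.Normal := (InfiniteGalois.normal_iff_isGalois E).mpr inferInstance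
  -- `ψ ∘ Art_M` kills `W_M ∩ Γ_E`
  have hkey : ∀ w : WeilGroup M, WeilGroup.toAbsGalois M w ∈ H → ψ (canonicalArtin M w) = 0 := by
    intro w hw
    have h1 : canonicalArtin M w ∈ (Units.map (Algebra.norm M : E →* M)).range :=
      (hart.artin_mem_range_norm_iff E w).mpr hw
    rw [hE] at h1
    exact hK _ h1
  -- every coset `σ H` meets the dense Weil group
  have hcoset : ∀ σ : absoluteGaloisGroup M, IsOpen {τ : absoluteGaloisGroup M | σ⁻¹ * τ ∈ H} :=
    fun σ => hHopen.preimage (continuous_const.mul continuous_id)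
  have hex : ∀ σ : absoluteGaloisGroup M, ∃ w : WeilGroup M,
      WeilGroup.toAbsGalois M w ∈ {τ : absoluteGaloisGroup M | σ⁻¹ * τ ∈ H} := fun σ =>
    (WeilGroup.denseRange_toAbsGalois_holds M).exists_mem_open (hcoset σ)
      ⟨σ, by simp [H.one_mem]⟩
  choose wσ hwσ using hex
  have hwσ' : ∀ σ, σ⁻¹ * WeilGroup.toAbsGalois M (wσ σ) ∈ H := hwσ
  -- `μ σ = ψ (Art (w_σ))` does not depend on the choice
  have hwd : ∀ (σ : absoluteGaloisGroup M) (w : WeilGroup M),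
      σ⁻¹ * WeilGroup.toAbsGalois M w ∈ H → ψ (canonicalArtin M (wσ σ)) = ψ (canonicalArtin M w) := by
    intro σ w hw
    have hmem : WeilGroup.toAbsGalois M ((wσ σ)⁻¹ * w) ∈ H := by
      rw [map_mul, map_inv]
      have : (WeilGroup.toAbsGalois M (wσ σ))⁻¹ * WeilGroup.toAbsGalois M w =
          (σ⁻¹ * WeilGroup.toAbsGalois M (wσ σ))⁻¹ * (σ⁻¹ * WeilGroup.toAbsGalois M w) := by group
      rw [this]
      exact H.mul_mem (H.inv_mem (hwσ' σ)) hw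
    have h0 := hkey _ hmem
    rw [map_mul, map_inv, hψ, character_apply_inv hψ, neg_add_eq_zero] at h0
    exact h0
  refine ⟨fun σ => ψ (canonicalArtin M (wσ σ)), ?_, fun σ τ => ?_, fun w => ?_⟩
  · refine isLocallyConstant_of_mul_mem _ H hHopen fun σ h hh => ?_
    refine hwd (σ * h) (wσ σ) ?_
    rw [mul_inv_rev, mul_assoc]
    exact H.mul_mem (H.inv_mem hh) (hwσ' σ)
  · dsimp only
    rw [hwd (σ * τ) (wσ σ * wσ τ), map_mul, hψ]
    rw [map_mul, mul_inv_rev, mul_assoc, ← mul_assoc σ⁻¹,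
      show τ⁻¹ * (σ⁻¹ * WeilGroup.toAbsGalois M (wσ σ) * WeilGroup.toAbsGalois M (wσ τ)) =
        τ⁻¹ * (σ⁻¹ * WeilGroup.toAbsGalois M (wσ σ)) * τ⁻¹⁻¹ *
          (τ⁻¹ * WeilGroup.toAbsGalois M (wσ τ)) by group]
    exact H.mul_mem (hHn.conj_mem _ (hwσ' σ) τ⁻¹) (hwσ' τ)
  · dsimp only
    exact hwd _ w (by rw [inv_mul_cancel]; exact H.one_mem)

end Galois

end Literature.NumberTheory.GaloisRepresentations

end
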